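import Summits.Langlands.Langlands.Theses.ThreeTorsionCollapse
import Literature.NumberTheory.Automorphic.TotallyRealModularityX0Fifteen
import HarnessLib

/-!
# BC3 birth skeleton — crux `BorelThreeAutomorphic` (item stmt-Langlands-18557, rev 1) of route `ThreeTorsionCollapse`

Skeleton registrar `planner-skel-stmt-Langlands-18557-0`, 2026-08-17 (route re-audit bin HONEST; mode
`skeleton-register`, gen 1). Published as `Summits/Langlands/Langlands/Cruxes/BorelThreeAutomorphic/Lines/birth.lean`
and registered with `ledger skeleton check … --crux stmt-Langlands-18557`. It re-registers, against the rev-1 item,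
the birth skeleton first filed for the rev-0 item stmt-Langlands-18326 (`planner-skel-stmt-Langlands-18326-0`):
the three stub NAMES and SIGNATURES are unchanged (the rev-1 restatement only wrote `IsAutomorphicOfWeightZero`
out by its definition — `borelThreeAutomorphic_iff_named : <crux> ↔ <named form> := Iff.rfl` below), the
assembly now concludes the crux BY NAME, and the BC3 probes were re-run against the rev-1 decl and the summit.

## The crux (rank 3 of `route-Langlands-ThreeTorsionCollapse`, "the Eisenstein cell")

`Summit.Langlands.Langlands.Theses.ThreeTorsionCollapse.BorelThreeAutomorphic`: for every totally real
number field `K`, every integral Weierstrass model `E / 𝓞 K` with `Δ(E) ≠ 0` and every framing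
`ρ̄ : Γ_K →ₜ* GL₂(ℤ/3)` of the Galois action on `E[3]` (an additive isomorphism `e : E[3](K̄) ≃ (ℤ/3)²`
with `e(σ • P) = ρ̄(σ) · e(P)` — literally `WeierstrassCurve.IsTorsionGaloisRep 3 ρ̄` written out) whose
matrices are upper-triangular (entry `(1,0)` zero: `E` has a `K`-rational `3`-isogeny), `E` is automorphic
of weight zero — `IsAutomorphicOfWeightZero E` written out: a weight-zero cuspidal `π` of `GL₂(𝔸_K)` with
Hecke polynomial `X² − a_w(E)·X + q_w` at every finite `w ∤ Δ(E)`.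

## The line: the programme's own printed doors at `5` and `7`, then a case split on `√5 ∈ K`

A curve in the Eisenstein cell that is NOT automorphic of weight zero is, by the PRINTED reductions,
simultaneously degenerate at `5` and `7`: Freitas–Le Hung–Siksek 2015 Thms. 3–4 (tree fact
`FLS2015_theorems3_4`, contrapositive `….not_modPImageAbsIrreducible`: `ρ̄_{E,p}(G_{K(ζ_p)})` absolutely
reducible for `p = 3, 5, 7`), Box 2022 Thm. 1.3 (ii) (= Thorne 2016 Thm. 7.6: if `√5 ∉ K` a framing of `E[5]`
is upper-triangular, i.e. a `K`-rational `5`-isogeny) and (iii) (Kalyanswamy 2018 + the FLS `e7` refinement: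
if `ℚ(ζ₇)⁺ ⊄ K` a framing of `E[7]` lands in `B(7)` or `G(e7)`), tree fact `Box2022_theorem1_3`. What is
left is exactly the two OPEN cores the route header names (TWO-LAYER PLAN: "BorelThreeAutomorphic ⇐
FifteenIsogenyCore → BorelSqrtFiveCore → BorelThreeAutomorphic"), typed here over existing declarations:

* `stub_fifteenIsogenyCore` (OPEN — the `X₀(15)` locus, `√5 ∉ K`): a curve over a totally real `K ∌ √5`
  with a `K`-rational `3`-isogeny AND a `K`-rational `5`-isogeny (a non-cuspidal `K`-point of `X₀(15)`),
  FLS-degenerate at `3, 5, 7` and Box-degenerate at `7`, is automorphic of weight zero. This is FLS's named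
  residue (arXiv:1310.7088 p. 4: "`X₀(15)` … has infinitely many real quadratic points, and there seems to
  be no simple way to prove that these points are modular"), known degree by degree only (size XL).
* `stub_borelSqrtFiveCore` (OPEN — the `√5 ∈ K` branch): a curve over a totally real `K ∋ √5` with a
  `K`-rational `3`-isogeny, FLS-degenerate at `3, 5, 7` and Box-degenerate at `7`, is automorphic of weight
  zero. Box 2022 §7.1 (arXiv:2103.13975 p. 30): "we cannot do any better than this at 5 without stronger
  modularity lifting results for fields containing `√5`" (size XL).
* `stub_printedDoors` (PRINTED, fact-stub — never a work target beyond citation): for a non-automorphic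
  `E` the three doors above. It is the conjunction of consequences of the two NAMED FACTS
  `Box2022_theorem1_3` and `FLS2015_theorems3_4` (unproved published theorems are `def … : Prop` in this
  tree, D-0014), and the sorry-free read-back `printedDoors_of_namedFacts : Box2022_theorem1_3 →
  FLS2015_theorems3_4 → <its statement>` below shows it is exactly that; registered as a stub only because
  the composition's hypotheses must be registered stubs (same device as the fact-stub of the registered
  `AdjointLiftingGL3` skeleton).

Assembly `BorelThreeAutomorphic_of_stubs (hA) (hB) (hC) : <the crux, by name>` is a real, short, sorry-free
proof (axioms `propext, Classical.choice, Quot.sound`): fix `K, E, ρ̄`; by contradiction, if `E` is not automorphic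
of weight zero, `hC` gives the doors; the Borel framing at `3` is `⟨ρ̄, hρ̄, hB₃⟩` (the crux hypothesis IS
`IsTorsionGaloisRep 3 ρ̄` by `rfl`); if `IsSquare (5 : K)` apply `hB`, else the door at `5` gives the
`5`-isogeny framing and `hA` applies — either way `E` is automorphic, contradiction. The skeleton theorem
`BorelThreeAutomorphic_of : BorelThreeAutomorphic := BorelThreeAutomorphic_of_stubs stub_… stub_… stub_…`
concludes the crux BY NAME (registrar shape). `sorry` occurs ONLY in the three `stub_*` bodies (lean check rc 0,
sorries = 3 = stubs, zero elsewhere; audit: `BorelThreeAutomorphic_of` class proof-of-item for the route decl,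
`BorelThreeAutomorphic_of_stubs` closed = true).

## BC3 probes (this seat's folder `bc/probes/`, farm 2026-08-17, against the REV-1 decl; every cell MUST FAIL)

Per (stub, target) the prescribed battery `first | exact? | simpa | aesop` and the sharper single cells
`exact?`, `simpa [T]`, `(unfold T; simpa)`, `aesop`, `(unfold T; aesop)` at `maxHeartbeats 400000`
(400k-timeouts re-run at 4 000 000); targets: the crux `…ThreeTorsionCollapse.BorelThreeAutomorphic` and the
summit `_root_.Langlands`. Results: see `Lines/birth.md` (table) — no cell closes; no stub is cheaply the crux
or the summit (A and B are the two field-branches of the open core, each strictly inside the crux's hypothesis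
locus with EXTRA degeneracy hypotheses at 5 and 7 the crux does not supply; C speaks only about NON-automorphic
curves and has no automorphy conclusion).

## Presearch (corpus fts+vec AND galaxy; inherited from the rev-0 registrar 2026-08-17 and re-checked)

* presearch: stub_fifteenIsogenyCore (modularity of the `X₀(15)` locus over all totally real `K ∌ √5`) →
  none field-uniform; per-degree only: [corpus:paper:arxiv-1310.7088 p.4] FLS residue quote + real quadratic
  case, [corpus:paper:arxiv-1505.04769 p.4] Thorne 2019 Lemma 3 / Prop. 4 (`X₀(15) = 15A1`, cyclic `K` with
  no new points), [corpus:paper:arxiv-2103.13975 pp.4–5] Box 2022 quartic, [corpus:paper:doi-10-4171-8ecm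
  p.681] Thorne ECM 2023 ("modularity over all totally real fields will require new ideas").
* presearch: stub_borelSqrtFiveCore (3-isogeny curves over totally real `K ∋ √5`) → none beyond `K = ℚ(√5)`
  (FLS 2015) [corpus:paper:arxiv-2103.13975 p.30 (§7.1 quote)].
* stub_printedDoors: in print and in tree by name (`Box2022_theorem1_3`, `FLS2015_theorems3_4`,
  `Thorne2016_theorem7_6`).

Disproof used: none exists for this crux (`ledger crux ls stmt-Langlands-18557`: no `Disproof.lean`, 2026-08-17).
Negatives index (Langlands): no entry bears on elliptic curves over totally real fields. Refuter crux-attack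
on the rev-1 item (2026-08-17T17:12Z, `CruxAttackCert.lean`): survives; both crux hypotheses load-bearing.
-/

set_option linter.dupNamespace false

open scoped NumberField MatrixGroups
open NumberField Field
open Literature.NumberTheory.GaloisRepresentations Literature.NumberTheory.Automorphic

noncomputable section

namespace Summit.Langlands.Langlands.Cruxes.BorelThreeAutomorphic.Birth

/-! ## 1. The registered stubs -/

/-- **Stub A — the `X₀(15)` locus (`√5 ∉ K`; OPEN, size XL, the crux's named residue).** For `K` totally
real with `¬ IsSquare (5 : K)` and `E / 𝓞 K` with `Δ(E) ≠ 0`: if `E[3]` admits an upper-triangular framing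
(`K`-rational `3`-isogeny) AND `E[5]` admits an upper-triangular framing (`K`-rational `5`-isogeny) — so `E`
is a non-cuspidal `K`-point of `X₀(15)` — and moreover `ρ̄_{E,p}(G_{K(ζ_p)})` is absolutely reducible for
`p = 3, 5, 7` (`¬ ModPImageAbsIrreducibleOverCyclotomic`, the FLS residual condition) and, when
`ℚ(ζ₇)⁺ ⊄ K` (`X³ + X² − 2X − 1` has no root in `K`), some framing of `E[7]` lands in `B(7)` or Box's
`G(e7) = ⟨(0 5; 3 0), (5 0; 3 2)⟩`, then `E` is automorphic of weight zero.
Why plausibly true: it is an instance of modularity of elliptic curves over totally real fields (conjunct (B)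
of the summit for `V_ℓ E`); KNOWN for `K = ℚ` (BCDT), real quadratic `K` (FLS 2015, incl. their treatment of
the real quadratic points of `X₀(15)`), cubic (Derickx–Najman–Siksek 2020), quartic `K ∌ √5` (Box 2022
Thm. 1.1), cyclic `K ∌ √5` with `X₀(15)(K) = X₀(15)(ℚ)` (Thorne 2019 Lemma 3 + Prop. 4, tree fact
`Thorne2019_lemma3_2`), the `ℤ_p`-cyclotomic towers (Thorne 2019, Yoshikawa).
Why it might fail / what is hard: the locus contains curves supersingular above `3` and `5` with
`7`-degenerate image, where no printed lifting theorem applies at any prime — Skinner–Wiles 1999 needs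
ordinary + distinguished, Thorne 2026 Thm. 4.1 needs ordinary and a modular approximation mod `ϖ^(80C+1)`,
Pan / Zhang need `K_v = ℚ_p` (barrier `ModPLanglandsGL2BeyondQpFpBar`); the Diophantine route (points of
`X₀(15)` degree by degree) cannot reach all `K`.
Leans on (tree): `WeierstrassCurve.IsTorsionGaloisRep`, `ModPImageAbsIrreducibleOverCyclotomic`,
`IsAutomorphicOfWeightZero`, `Thorne2019_lemma3_2`, the `X₀(15)` models of `CaraianiNewtonModularityProofs`.
[cite: FreitasLeHungSiksek2015, Thm. 1 and p. 4] [cite: Thorne2019, Lemma 3, Prop. 4] [cite: Box2022, Thm. 1.1]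
[cite: SkinnerWiles1999, Thm. A] -/
theorem stub_fifteenIsogenyCore :
    ∀ (K : Type) [Field K] [NumberField K] [IsTotallyReal K], ¬ IsSquare (5 : K) →
      ∀ E : WeierstrassCurve (𝓞 K), E.Δ ≠ 0 →
        (∃ ρ₃ : FramedGaloisRep K (ZMod 3) 2, (E.baseChange K).IsTorsionGaloisRep 3 ρ₃ ∧
          ∀ σ : absoluteGaloisGroup K,
            ((ρ₃ σ : GL (Fin 2) (ZMod 3)) : Matrix (Fin 2) (Fin 2) (ZMod 3)) 1 0 = 0) →
        (∃ ρ₅ : FramedGaloisRep K (ZMod 5) 2, (E.baseChange K).IsTorsionGaloisRep 5 ρ₅ ∧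
          ∀ σ : absoluteGaloisGroup K,
            ((ρ₅ σ : GL (Fin 2) (ZMod 5)) : Matrix (Fin 2) (Fin 2) (ZMod 5)) 1 0 = 0) →
        (∀ (p : ℕ) [Fact p.Prime], (p = 3 ∨ p = 5 ∨ p = 7) →
          ¬ ModPImageAbsIrreducibleOverCyclotomic (E.baseChange K) p) →
        ((∀ x : K, x ^ 3 + x ^ 2 - 2 * x - 1 ≠ 0) →
          ∃ ρ₇ : FramedGaloisRep K (ZMod 7) 2, (E.baseChange K).IsTorsionGaloisRep 7 ρ₇ ∧
            ((∀ σ : absoluteGaloisGroup K,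
                ((ρ₇ σ : GL (Fin 2) (ZMod 7)) : Matrix (Fin 2) (Fin 2) (ZMod 7)) 1 0 = 0) ∨
              (∀ σ : absoluteGaloisGroup K, (ρ₇ σ : GL (Fin 2) (ZMod 7)) ∈
                Subgroup.closure ({(⟨!![0, 5; 3, 0], !![0, 5; 3, 0], by decide, by decide⟩ :
                    GL (Fin 2) (ZMod 7)),
                  (⟨!![5, 0; 3, 2], !![3, 0; 6, 4], by decide, by decide⟩ : GL (Fin 2) (ZMod 7))} :
                  Set (GL (Fin 2) (ZMod 7)))))) →
        IsAutomorphicOfWeightZero E := by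
  sorry

/-- **Stub B — the `√5 ∈ K` branch of the Eisenstein cell (OPEN, size XL).** For `K` totally real with
`IsSquare (5 : K)` and `E / 𝓞 K` with `Δ(E) ≠ 0`: if `E[3]` admits an upper-triangular framing
(`K`-rational `3`-isogeny), `ρ̄_{E,p}(G_{K(ζ_p)})` is absolutely reducible for `p = 3, 5, 7` (for `p = 5`
and `√5 ∈ K`, `[K(ζ₅) : K] ≤ 2`: image in `B(5)` or in one of the FLS exceptional subgroups of orders
`6, 8, 12` with `det ∈ {1, 4}`, arXiv:1310.7088 p. 20) and, when `ℚ(ζ₇)⁺ ⊄ K`, some framing of `E[7]` lands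
in `B(7)` or `G(e7)`, then `E` is automorphic of weight zero.
Why plausibly true: again an instance of conjunct (B); KNOWN for `K = ℚ(√5)` (FLS 2015, all curves over
`ℚ(√5)`), and for the `5`-large-image part of any `K` (FLS Thm. 3 at `p = 5`, which treats `√5 ∈ K`).
Why it might fail / what is hard: Box 2022 §7.1 — "we cannot do any better than this at 5 without stronger
modularity lifting results for fields containing `√5`", "`ℚ(√5)`-curves … are not known to be modular";
Thorne 2016 Thm. 7.6 needs `√5 ∉ K` (his dihedral lifting theorem degenerates when `K(ζ₅)/K` is quadratic);
the supersingular-above-`3` sub-core has no printed engine (same barrier placement as stub A).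
Leans on (tree): `WeierstrassCurve.IsTorsionGaloisRep`, `ModPImageAbsIrreducibleOverCyclotomic`,
`IsAutomorphicOfWeightZero`; route `SqrtFiveQuarticCovers` attacks the quartic `K ∋ √5` sub-case by points.
[cite: Box2022, §7.1] [cite: FreitasLeHungSiksek2015, Thm. 3 and Part 4] [cite: Thorne2016, Thm. 7.6] -/
theorem stub_borelSqrtFiveCore :
    ∀ (K : Type) [Field K] [NumberField K] [IsTotallyReal K], IsSquare (5 : K) →
      ∀ E : WeierstrassCurve (𝓞 K), E.Δ ≠ 0 →
        (∃ ρ₃ : FramedGaloisRep K (ZMod 3) 2, (E.baseChange K).IsTorsionGaloisRep 3 ρ₃ ∧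
          ∀ σ : absoluteGaloisGroup K,
            ((ρ₃ σ : GL (Fin 2) (ZMod 3)) : Matrix (Fin 2) (Fin 2) (ZMod 3)) 1 0 = 0) →
        (∀ (p : ℕ) [Fact p.Prime], (p = 3 ∨ p = 5 ∨ p = 7) →
          ¬ ModPImageAbsIrreducibleOverCyclotomic (E.baseChange K) p) →
        ((∀ x : K, x ^ 3 + x ^ 2 - 2 * x - 1 ≠ 0) →
          ∃ ρ₇ : FramedGaloisRep K (ZMod 7) 2, (E.baseChange K).IsTorsionGaloisRep 7 ρ₇ ∧
            ((∀ σ : absoluteGaloisGroup K,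
                ((ρ₇ σ : GL (Fin 2) (ZMod 7)) : Matrix (Fin 2) (Fin 2) (ZMod 7)) 1 0 = 0) ∨
              (∀ σ : absoluteGaloisGroup K, (ρ₇ σ : GL (Fin 2) (ZMod 7)) ∈
                Subgroup.closure ({(⟨!![0, 5; 3, 0], !![0, 5; 3, 0], by decide, by decide⟩ :
                    GL (Fin 2) (ZMod 7)),
                  (⟨!![5, 0; 3, 2], !![3, 0; 6, 4], by decide, by decide⟩ : GL (Fin 2) (ZMod 7))} :
                  Set (GL (Fin 2) (ZMod 7)))))) →
        IsAutomorphicOfWeightZero E := by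
  sorry

/-- **Stub C — the printed doors at `5` and `7` (PRINTED; fact-stub, dischargeable BY NAME:
`printedDoors_of_namedFacts`).** For `K` totally real and `E / 𝓞 K` with `Δ(E) ≠ 0` NOT automorphic of
weight zero: (a) if `√5 ∉ K`, some framing of `E[5]` is upper-triangular — Box 2022 Thm. 1.3 (ii), i.e. the
contrapositive of Thorne 2016 Thm. 7.6; (b) `ρ̄_{E,p}(G_{K(ζ_p)})` is absolutely reducible for `p = 3, 5, 7`
— Freitas–Le Hung–Siksek 2015 Thms. 3–4, contrapositive; (c) if `X³ + X² − 2X − 1` has no root in `K`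
(`K ∩ ℚ(ζ₇) = ℚ`), some framing of `E[7]` lands in `B(7)` or `G(e7)` — Box 2022 Thm. 1.3 (iii)
(Kalyanswamy 2018 + FLS). Never a work target beyond citing the named facts `Box2022_theorem1_3` and
`FLS2015_theorems3_4`; registered as a stub only because the composition's hypotheses must be stubs.
[cite: Box2022, Thm. 1.3] [cite: FreitasLeHungSiksek2015, Thm. 3 and Thm. 4] [cite: Thorne2016, Thm. 7.6] -/
theorem stub_printedDoors :
    ∀ (K : Type) [Field K] [NumberField K] [IsTotallyReal K] (E : WeierstrassCurve (𝓞 K)),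
      E.Δ ≠ 0 → ¬ IsAutomorphicOfWeightZero E →
        (¬ IsSquare (5 : K) →
          ∃ ρ₅ : FramedGaloisRep K (ZMod 5) 2, (E.baseChange K).IsTorsionGaloisRep 5 ρ₅ ∧
            ∀ σ : absoluteGaloisGroup K,
              ((ρ₅ σ : GL (Fin 2) (ZMod 5)) : Matrix (Fin 2) (Fin 2) (ZMod 5)) 1 0 = 0) ∧
        (∀ (p : ℕ) [Fact p.Prime], (p = 3 ∨ p = 5 ∨ p = 7) →
          ¬ ModPImageAbsIrreducibleOverCyclotomic (E.baseChange K) p) ∧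
        ((∀ x : K, x ^ 3 + x ^ 2 - 2 * x - 1 ≠ 0) →
          ∃ ρ₇ : FramedGaloisRep K (ZMod 7) 2, (E.baseChange K).IsTorsionGaloisRep 7 ρ₇ ∧
            ((∀ σ : absoluteGaloisGroup K,
                ((ρ₇ σ : GL (Fin 2) (ZMod 7)) : Matrix (Fin 2) (Fin 2) (ZMod 7)) 1 0 = 0) ∨
              (∀ σ : absoluteGaloisGroup K, (ρ₇ σ : GL (Fin 2) (ZMod 7)) ∈
                Subgroup.closure ({(⟨!![0, 5; 3, 0], !![0, 5; 3, 0], by decide, by decide⟩ :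
                    GL (Fin 2) (ZMod 7)),
                  (⟨!![5, 0; 3, 2], !![3, 0; 6, 4], by decide, by decide⟩ : GL (Fin 2) (ZMod 7))} :
                  Set (GL (Fin 2) (ZMod 7)))))) := by
  sorry

/-! ## 2. Read-back: the fact-stub IS the printed content (sorry-free, from the two named facts) -/

/-- `stub_printedDoors` follows from the named facts `Box2022_theorem1_3` ((ii) and (iii)) and
`FLS2015_theorems3_4` (contrapositive `….not_modPImageAbsIrreducible`) — so stub C is discharged the moment
the crux is allowed to take those facts as hypotheses. [cite: Box2022, Thm. 1.3] [cite: FreitasLeHungSiksek2015, Thm. 3 and Thm. 4] -/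
theorem printedDoors_of_namedFacts (hBox : Box2022_theorem1_3) (h34 : FLS2015_theorems3_4) :
    type_of% @stub_printedDoors := by
  intro K _ _ _ E hΔ hne
  exact ⟨(hBox K E hΔ hne).2.1, fun p _ hp => h34.not_modPImageAbsIrreducible K hΔ hne p hp,
    (hBox K E hΔ hne).2.2⟩

/-- **Read-back of the rev-1 crux against the named predicate (`Iff.rfl`).** Since cone-repair rev 1 the
route decl writes `IsAutomorphicOfWeightZero E` out by its definition (and the framing hypothesis is
`WeierstrassCurve.IsTorsionGaloisRep 3 ρ` written out); both agree with the named Literature predicates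
definitionally, so stubs A and B (which conclude the named predicate) assemble to the crux with no rewriting. -/
theorem borelThreeAutomorphic_iff_named :
    Summit.Langlands.Langlands.Theses.ThreeTorsionCollapse.BorelThreeAutomorphic ↔
      ∀ (K : Type) [Field K] [NumberField K] [IsTotallyReal K] (E : WeierstrassCurve (𝓞 K)), E.Δ ≠ 0 →
        ∀ ρ : FramedGaloisRep K (ZMod 3) 2, (E.baseChange K).IsTorsionGaloisRep 3 ρ →
          (∀ σ : absoluteGaloisGroup K,
            ((ρ σ : GL (Fin 2) (ZMod 3)) : Matrix (Fin 2) (Fin 2) (ZMod 3)) 1 0 = 0) →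
          IsAutomorphicOfWeightZero E :=
  Iff.rfl

/-! ## 3. Assembly — the crux from the three stub STATEMENTS (kernel-checked, no `sorry`) -/

/-- **ASSEMBLY (kernel-checked, no `sorry`; axioms `propext`, `Classical.choice`, `Quot.sound`).** The
three stub statements (binders are the stub statements literally, `type_of%`) imply the crux, concluded BY
NAME (`Summit.Langlands.Langlands.Theses.ThreeTorsionCollapse.BorelThreeAutomorphic`, rev 1 = item
stmt-Langlands-18557: conclusion `IsAutomorphicOfWeightZero E` written out; the stubs keep the named predicate and
the two agree definitionally — `borelThreeAutomorphic_iff_named` below is `Iff.rfl`).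
Fix `K`, `E`, a framing `ρ̄` of `E[3]` with upper-triangular matrices; suppose `E` is not automorphic of
weight zero. Stub C gives the doors at `5` and `7`; the crux's written-out framing hypothesis is
`(E ⊗ K).IsTorsionGaloisRep 3 ρ̄` definitionally, so `⟨ρ̄, hρ̄, hB⟩` is the Borel framing at `3`. If `5` is a
square in `K`, stub B concludes; otherwise door (a) yields an upper-triangular framing of `E[5]` and stub A
concludes. Either way `E` is automorphic of weight zero — contradiction.
[cite: Box2022, Thm. 1.3] [cite: FreitasLeHungSiksek2015, Thm. 3 and Thm. 4] -/
theorem BorelThreeAutomorphic_of_stubs (hA : type_of% @stub_fifteenIsogenyCore)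
    (hB : type_of% @stub_borelSqrtFiveCore) (hC : type_of% @stub_printedDoors) :
    Summit.Langlands.Langlands.Theses.ThreeTorsionCollapse.BorelThreeAutomorphic := by
  intro K _ _ _ E hΔ ρ hρ hbor
  by_contra hne
  obtain ⟨h5, hdeg, h7⟩ := hC K E hΔ hne
  have h3 : ∃ ρ₃ : FramedGaloisRep K (ZMod 3) 2, (E.baseChange K).IsTorsionGaloisRep 3 ρ₃ ∧
      ∀ σ : absoluteGaloisGroup K,
        ((ρ₃ σ : GL (Fin 2) (ZMod 3)) : Matrix (Fin 2) (Fin 2) (ZMod 3)) 1 0 = 0 :=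
    ⟨ρ, hρ, hbor⟩
  by_cases hsq : IsSquare (5 : K)
  · exact hne (hB K hsq E hΔ h3 hdeg h7)
  · exact hne (hA K hsq E hΔ h3 (h5 hsq) hdeg h7)

/-- **THE SKELETON THEOREM (registrar shape).** The crux
`Summit.Langlands.Langlands.Theses.ThreeTorsionCollapse.BorelThreeAutomorphic`, concluded BY NAME from the
three declared stubs through the sorry-free assembly `BorelThreeAutomorphic_of_stubs`; the only `sorry`s in
its closure are `stub_fifteenIsogenyCore`, `stub_borelSqrtFiveCore`, `stub_printedDoors`. -/
theorem BorelThreeAutomorphic_of :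
    Summit.Langlands.Langlands.Theses.ThreeTorsionCollapse.BorelThreeAutomorphic :=
  BorelThreeAutomorphic_of_stubs stub_fifteenIsogenyCore stub_borelSqrtFiveCore stub_printedDoors

end Summit.Langlands.Langlands.Cruxes.BorelThreeAutomorphic.Birth

end
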